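import Summits.BirchSwinnertonDyer.BirchSwinnertonDyer.Theorems.AlignedTransportAtTwoMainConjectureOfRankZeroBSDAtTwoHalfDescentBaseRing
import Summits.BirchSwinnertonDyer.BirchSwinnertonDyer.Theorems.AlignedTransportAtTwoMainConjectureOfRankZeroBSDAtTwoHalfDescentLayerIndexCertificate
import Summits.BirchSwinnertonDyer.BirchSwinnertonDyer.Theorems.AlignedTransportAtTwoMainConjectureOfRankZeroBSDAtTwoHalfDescentLayerIndexGrowth
import HarnessLib

/-!
# Route `AlignedTransportAtTwo`, crux C2 `MainConjectureOfRankZeroBSDAtTwo` (stmt-BirchSwinnertonDyer-22298):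
# THE BASE TERM CARRIES `p^μ`, II — THE BASE INDEX: for EVERY finitely generated torsion `Λ`-module `X` with `char_Λ X = (f)` and largest finite submodule `F`:
# `#(X/TX) = p^{ord_p f(0)} · #(F/TF)` if `f(0) ≠ 0`, `#(X/TX) = 0` (infinite) if `f(0) = 0`; hence `p^{μ(X)} ∣ #(X/TX)` and `p^{pⁿ·μ(X)} ∣ #(X/ω_nX)` for EVERY `n`
# UNCONDITIONALLY, the `γ`-free one-layer certificate `0 < #(X/ω_nX) < p^{pⁿ} ⟹ μ(X) = 0`, and `p ∤ #(X/TX) ⟹ μ = λ = 0`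

HONEST FRAMING (cell `bsd-f1-sign2`, WIDTH-5 attached prover seat `bsd-line-att-p5` gen 60 on line `birth` of the lead `bsd-line-att-p2`;
`--supports` stmt-BirchSwinnertonDyer-22298, closes nothing; BSD is NOT proved by any of this; the crux C2, its verdict «blocked-on
`Rank1Residual.GreenbergMuConjectureIrreducible`» and every registered stub (P / T / Kμ / LimDoor / MuIneqʳ / PFμ⁺) are untouched). THEOREMS ONLY —
pure commutative algebra over `Λ = ℤ_p⟦T⟧`, any prime `p`; no `def`, no instance, no named fact, no `sorry`. Sequel of this gen's `…HalfDescentBaseRing` (`𝒪₀ = Λ/(T)` is a DVR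
with residue field `𝔽_p`, `#N = p^{length_{𝒪₀} N}`, `#Λ/(f, T) = p^{ord_p f(0)}`, `p^{μ(f)} ∣ #Λ/(f, T)`) in the frame of gens 54–55 (`…LayerIndexModule`: square presentation
`Λⁿ —P→ Λⁿ ↠ X/F`, `(f) = Fitt₀ = (det P)`, Fulton's `length = ord(det)`; `…LayerIndexCertificate`: `g ∣ f ⟹ X/gX` infinite; `…LayerIndexFinite`: `0 → F/aF → X/aX → (X/F)/a → 0`
for `a` regular on `X/F`) and gen 56 (`…LayerIndexGrowth.pow_mul_natCard_dvd_natCard_quotient_omega`: `p^{(pⁿ−1)μ(X)}·#(X/TX) ∣ #(X/ω_nX)` — the base factor `#(X/TX)` OPAQUE).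

THE POINT. `X` ANY finitely generated torsion `Λ`-module, `char_Λ X = (f)`, `F` its largest finite submodule (`X/F` has none; tree).
* §1 (no finite submodule, `T ∤ f`) ★ `natCard_quotient_X_smul_top_eq_natCard_quotient_span_sup`: **`#(X/TX) = #Λ/(f, T)`**; ★★ `natCard_quotient_X_smul_top_eq_pow`:
  **`#(X/TX) = p^{ord_p f(0)}`** — the base case `ω_0 = T` of g54's exact layer index, with NO condition on `λ(f)` (for `Ψ_n` one needs `λ(f) < φ(p^{n+1})`).
* §2 (general `X`) ★★ `natCard_quotient_X_smul_top_eq_zero_of_constantCoeff_eq_zero` (`f(0) = 0 ⟹ X/TX` infinite) and its converse `natCard_quotient_X_smul_top_ne_zero_iff`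
  (`X/TX` finite ⟺ `f(0) ≠ 0`); ★★★ `natCard_quotient_X_smul_top_eq_pow_mul`: **`#(X/TX) = p^{ord_p f(0)} · #(F/TF)`** (`f(0) ≠ 0`; Iwasawa's `e_0` EXACT: `ν`-part `= #F[T]`);
  ★★★ **`pow_mu_dvd_natCard_quotient_X_smul_top` / `pow_muInvariant_dvd_natCard_quotient_X_smul_top`: `p^{μ(X)} ∣ #(X/TX)` UNCONDITIONALLY**;
  ★★★ **`pow_mul_muInvariant_dvd_natCard_quotient_omega`: `p^{pⁿ·μ(X)} ∣ #(X/ω_nX)` for EVERY `n`** (gen 56 had `p^{(pⁿ−1)μ}·#(X/TX) ∣`);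
  ★★★ **`muInvariant_eq_zero_of_natCard_quotient_omega_pos_lt`: `0 < #(X/ω_nX) < p^{pⁿ}` at ANY ONE `n` ⟹ `μ(X) = 0`** — the weakest-input certificate of the lineage: ONE
  index of `ω`-coinvariants (in Selmer currency ONE group of invariants `Sel_∞^{Γ_n}`, at finite level `#Sel_{p^∞}(E/K_n)·#ker g_n` — sequel `…BaseIndexSelmer`), no growth
  number (g56: `0 < #(X/ω_{n+1}X) < p^{pⁿ(p−1)}·#(X/ω_nX)`), no relative norm (g55), no `λ`, no `γ`-action; ★★ `pow_mul_muInvariant_le_log`: `pⁿ·μ(X) ≤ log_p #(X/ω_nX)`.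
* §3 (what the base index knows about `λ`) ★★ `natCard_quotient_X_smul_top_eq_pow_mu_mul_iff`: **`#(X/TX) = p^{μ(f)}·#(F/TF) ⟺ λ(f) = 0`**; no finite submodule:
  **`#(X/TX) = p^{μ(f)} ⟺ λ(f) = 0`**; ★★ `pow_mu_succ_dvd_natCard_quotient_X_smul_top_of_lam_ne_zero`: `λ(f) ≠ 0 ⟹ p^{μ(f)+1} ∣ #(X/TX)`;
  ★★★ **`mu_eq_zero_and_lam_eq_zero_of_not_dvd`: `p ∤ #(X/TX) ⟹ μ(f) = 0 ∧ λ(f) = 0 ∧ char_Λ X = Λ`** (THE BASE DOOR).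
Reading for C2 (`p = 2`): `#(X/TX) = #Sel_{2^∞}(W/ℚ_∞)^Γ = #Sel_{2^∞}(W/ℚ)·#ker g_0(W)` on the seed cell (Lemma 4.3, `E(ℚ)[2] = 0`), so `2^{μ₂} ∣ #Sel_{2^∞}(W/ℚ)·#ker g_0(W)` — WITHOUT
gen 59's second kernel `#ker g_1(W)` and without its twist transport; and `2^{2ⁿμ₂} ∣ #Sel_{2^∞}(W/ℚ_n)·#ker g_n` at every layer (sequel). What is NOT claimed: nothing about any curve;
no index computed. Memo `Cruxes/MainConjectureOfRankZeroBSDAtTwo/BASE-TERM-att-p5-g60.md`.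

References: L. Washington, GTM 83, §7.1, §13.2 (Lemma 13.16, Prop. 13.8), §13.3 (Lemmas 13.18–13.21, Thm. 13.13) [Washington1997]; W. Fulton, *Intersection Theory*,
Lemma A.2.6 [Fulton1998]; The Stacks Project, Tags 07Z6, 02MI [StacksProject]; J. Neukirch, A. Schmidt, K. Wingberg, (5.3.1), (5.3.17) [NeukirchSchmidtWingberg2008];
R. Greenberg, LNM 1716 (1999), Thm. 1.10, Conj. 1.11, §4 Lemma 4.2 (p. 103), p. 104 [GreenbergLNM1716]; B. Perrin-Riou, Bull. SMF 115 (1987) §1 (lemme de spécialisation).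
-/

set_option linter.dupNamespace false
set_option autoImplicit false

noncomputable section

open scoped Classical Polynomial

namespace Summit.BirchSwinnertonDyer.BirchSwinnertonDyer.Theorems.AlignedTransportAtTwoHalfDescentBaseIndex

open Literature.NumberTheory.EllipticCurves Literature.NumberTheory.EllipticCurves.IwasawaAlgebra
  Literature.RingTheory.FittingIdeal Literature.RingTheory.OrderOfVanishing
  Summit.BirchSwinnertonDyer.Rank1Residual.X1.MuLambda
  Summit.BirchSwinnertonDyer.Rank1Residual.X1.ParitySqueeze
  Summit.BirchSwinnertonDyer.Rank1Residual.X1.GeneratorBoundOrd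
  Summit.BirchSwinnertonDyer.Rank1Residual.X1.GeneratorBoundMu
  Summit.BirchSwinnertonDyer.Rank1Residual.Iwasawa
  Summit.BirchSwinnertonDyer.BirchSwinnertonDyer.Theorems.DefectPrime
  Summit.BirchSwinnertonDyer.BirchSwinnertonDyer.Theorems.AlignedTransportAtTwoCyclotomicLayerPrime
  Summit.BirchSwinnertonDyer.BirchSwinnertonDyer.Theorems.AlignedTransportAtTwoHalfDescentLayerRing
  Summit.BirchSwinnertonDyer.BirchSwinnertonDyer.Theorems.AlignedTransportAtTwoHalfDescentLayerIndex
  Summit.BirchSwinnertonDyer.BirchSwinnertonDyer.Theorems.AlignedTransportAtTwoHalfDescentLayerIndexModule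
  Summit.BirchSwinnertonDyer.BirchSwinnertonDyer.Theorems.AlignedTransportAtTwoHalfDescentLayerIndexTower
  Summit.BirchSwinnertonDyer.BirchSwinnertonDyer.Theorems.AlignedTransportAtTwoHalfDescentLayerIndexFinite
  Summit.BirchSwinnertonDyer.BirchSwinnertonDyer.Theorems.AlignedTransportAtTwoHalfDescentLayerIndexCertificate
  Summit.BirchSwinnertonDyer.BirchSwinnertonDyer.Theorems.AlignedTransportAtTwoHalfDescentLayerIndexGrowth
  Summit.BirchSwinnertonDyer.BirchSwinnertonDyer.Theorems.AlignedTransportAtTwoHalfDescentBaseRing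

universe u

variable {p : ℕ} [hp : Fact p.Prime] {M : Type u} [AddCommGroup M] [Module (IwasawaAlgebra p) M]

/-! ## §1 No finite submodule: the base index of the module is the base index of its characteristic series -/

section NoFinite

/-- ★ **THE BASE INDEX OF A MODULE WITHOUT FINITE SUBMODULE IS THE CYCLIC BASE INDEX.** `X` f.g. torsion over `Λ` WITHOUT non-zero finite submodule, `char_Λ X = (f)`,
`T ∤ f`. Then **`#(X/TX) = #Λ/(f, T)`** (`= p^{ord_p f(0)}`): square presentation `Λⁿ —P→ Λⁿ ↠ X` (`pd_Λ X ≤ 1`), `(f) = Fitt₀(X) = (det P)`; modulo `T`: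
`X/TX ≅ 𝒪₀ⁿ/P̄ᵀ𝒪₀ⁿ` over the DVR `𝒪₀ = Λ/(T)` (file I); Fulton's `length_{𝒪₀}(𝒪₀ⁿ/P̄ᵀ𝒪₀ⁿ) = length_{𝒪₀}(𝒪₀/(det P̄)) = length_{𝒪₀}(𝒪₀/(f̄))`, and `#N = p^{length N}` on
both sides. (g54/g55 proved this for EISENSTEIN `g`; `T` is the missing base case.) [cite: Fulton1998, Lemma A.2.6] [cite: StacksProject, Tag 07Z6] [cite: Washington1997, §13.3] -/
theorem natCard_quotient_X_smul_top_eq_natCard_quotient_span_sup [Module.Finite (IwasawaAlgebra p) M] (hM : Module.IsTorsion (IwasawaAlgebra p) M)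
    (hnf : ∀ N : Submodule (IwasawaAlgebra p) M, Finite N → N = ⊥) {f : IwasawaAlgebra p}
    (hchar : Literature.NumberTheory.EllipticCurves.Module.charIdeal (IwasawaAlgebra p) M = Ideal.span {f}) (hTf : ¬ (PowerSeries.X : IwasawaAlgebra p) ∣ f) :
    Nat.card (M ⧸ (Ideal.span {(PowerSeries.X : IwasawaAlgebra p)} • ⊤ : Submodule (IwasawaAlgebra p) M)) =
      Nat.card (IwasawaAlgebra p ⧸ (Ideal.span {f} ⊔ Ideal.span {(PowerSeries.X : IwasawaAlgebra p)})) := by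
  classical
  letI hdom := SkinnerUrban2014.isDomain_quotient_span_X p
  letI hdvr := isDiscreteValuationRing_quotient_X p
  -- a square presentation `π : Λⁿ ↠ X`, `ker π` free with basis rows `P`
  obtain ⟨n, x, hx⟩ := Module.Finite.exists_fin (R := IwasawaAlgebra p) (M := M)
  let π : (Fin n → IwasawaAlgebra p) →ₗ[IwasawaAlgebra p] M := Fintype.linearCombination _ x
  have hπ : ∀ c, π c = ∑ i, c i • x i := fun c ↦ Fintype.linearCombination_apply _ _ c
  have hsurj : Function.Surjective π := by
    rw [← LinearMap.range_eq_top, eq_top_iff, ← hx, Submodule.span_le]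
    rintro _ ⟨i, rfl⟩
    refine ⟨Pi.single i 1, ?_⟩
    rw [hπ, Finset.sum_eq_single i (fun j _ hj ↦ by rw [Pi.single_eq_of_ne hj, zero_smul]) (fun hi ↦ absurd (Finset.mem_univ i) hi),
      Pi.single_eq_same, one_smul]
  haveI := free_ker π hnf
  let b : Module.Basis (Fin n) (IwasawaAlgebra p) (LinearMap.ker π) := Module.finBasisOfFinrankEq _ _ (finrank_ker_eq π hsurj hM)
  let P : Matrix (Fin n) (Fin n) (IwasawaAlgebra p) := Matrix.of fun t l ↦ ((b t : LinearMap.ker π) : Fin n → IwasawaAlgebra p) l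
  have hPb : ∀ t, P t = ((b t : LinearMap.ker π) : Fin n → IwasawaAlgebra p) := fun t ↦ rfl
  have hP : ∀ t, ∑ l, P t l • x l = 0 := fun t ↦ by
    have h2 := (b t).2
    rw [LinearMap.mem_ker, hπ] at h2
    simpa [P] using h2
  have hK : LinearMap.ker π = Submodule.span (IwasawaAlgebra p) (Set.range P) := by
    have e : Set.range P = (LinearMap.ker π).subtype '' Set.range b := by rw [← Set.range_comp]; rfl
    rw [e, Submodule.span_image, b.span_eq, Submodule.map_subtype_top]
  have hgen : ∀ ρ : Fin n → IwasawaAlgebra p, ∑ l, ρ l • x l = 0 → ρ ∈ Submodule.span (IwasawaAlgebra p) (Set.range P) := fun ρ hρ ↦ by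
    rw [← hK, LinearMap.mem_ker, hπ]; exact hρ
  -- `(f) = Fitt₀(X) = (det P)`
  have hspan : Ideal.span {f} = Ideal.span {P.det} := by
    rw [← hchar, charIdeal_eq_fittingIdeal_zero hM hnf, Module.fittingIdeal_zero_eq_span_det_of_square_presentation x hx P hP hgen]
  -- pass to `𝒪₀ = Λ/(T)`
  rw [natCard_quotient_smul_top_eq_of_presentation π hsurj P hK (Ideal.span {(PowerSeries.X : IwasawaAlgebra p)})]
  set Q : Matrix (Fin n) (Fin n) (IwasawaAlgebra p ⧸ Ideal.span {(PowerSeries.X : IwasawaAlgebra p)}) :=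
    P.transpose.map (Ideal.Quotient.mk (Ideal.span {(PowerSeries.X : IwasawaAlgebra p)})) with hQ
  have hQdet : Q.det = Ideal.Quotient.mk (Ideal.span {(PowerSeries.X : IwasawaAlgebra p)}) P.det := by
    rw [hQ, ← RingHom.mapMatrix_apply, ← RingHom.map_det, Matrix.det_transpose]
  have hspanQ : Ideal.span {Q.det} = Ideal.span {Ideal.Quotient.mk (Ideal.span {(PowerSeries.X : IwasawaAlgebra p)}) f} := by
    have h := congrArg (Ideal.map (Ideal.Quotient.mk (Ideal.span {(PowerSeries.X : IwasawaAlgebra p)}))) hspan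
    rw [Ideal.map_span, Ideal.map_span, Set.image_singleton, Set.image_singleton] at h
    rw [hQdet, h]
  have hQdet0 : Q.det ≠ 0 := by
    intro h0
    have hmem : Ideal.Quotient.mk (Ideal.span {(PowerSeries.X : IwasawaAlgebra p)}) f ∈ Ideal.span {Q.det} := by
      rw [hspanQ]; exact Ideal.mem_span_singleton_self _
    rw [h0, Ideal.span_singleton_zero, Ideal.mem_bot, Ideal.Quotient.eq_zero_iff_mem, Ideal.mem_span_singleton] at hmem
    exact hTf hmem
  -- `f(0) ≠ 0`, so the cyclic side is finite of order `p^{ord_p f(0)}`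
  have h0 : PowerSeries.constantCoeff f ≠ 0 := fun h ↦ hTf (PowerSeries.X_dvd_iff.mpr h)
  -- Fulton A.2.6 over the DVR `𝒪₀`
  have hlen := length_quotient_range_toLin'_eq_ord_det Q hQdet0
  rw [Ring.ord] at hlen
  have hfin2 : Finite ((IwasawaAlgebra p ⧸ Ideal.span {(PowerSeries.X : IwasawaAlgebra p)}) ⧸ Ideal.span {Q.det}) := by
    apply Nat.finite_of_card_ne_zero
    rw [Nat.card_congr (Submodule.quotEquivOfEq _ _ hspanQ).toEquiv, natCard_quotient_span_mk h0]
    exact pow_ne_zero _ hp.out.ne_zero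
  have hlen2 : Module.length (IwasawaAlgebra p ⧸ Ideal.span {(PowerSeries.X : IwasawaAlgebra p)})
      ((IwasawaAlgebra p ⧸ Ideal.span {(PowerSeries.X : IwasawaAlgebra p)}) ⧸ Ideal.span {Q.det}) ≠ ⊤ :=
    Module.length_ne_top_iff.mpr Module.isFiniteLength_of_finite
  have hfl : IsFiniteLength (IwasawaAlgebra p ⧸ Ideal.span {(PowerSeries.X : IwasawaAlgebra p)})
      ((Fin n → IwasawaAlgebra p ⧸ Ideal.span {(PowerSeries.X : IwasawaAlgebra p)}) ⧸ LinearMap.range (Matrix.toLin' Q)) := by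
    rw [← Module.length_ne_top_iff, hlen]
    exact hlen2
  rw [natCard_eq_pow_length_quotient_X p hfl, hlen, ← natCard_eq_pow_length_quotient_X_of_finite p,
    Nat.card_congr (Submodule.quotEquivOfEq _ _ hspanQ).toEquiv, natCard_quotient_span_mk h0, natCard_quotient_span_sup_span_X h0]

/-- ★★ **`#(X/TX) = p^{ord_p f(0)}`** for `X` f.g. torsion WITHOUT non-zero finite submodule, `char_Λ X = (f)`, `f(0) ≠ 0` — the base case (`ω_0 = T`) of g54's exact layer index,
with NO condition on `λ(f)`. [cite: Washington1997, §13.3 (Lemma 13.18, Thm. 13.13)] [cite: GreenbergLNM1716, §4 Lemma 4.2 (p. 103)] -/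
theorem natCard_quotient_X_smul_top_eq_pow [Module.Finite (IwasawaAlgebra p) M] (hM : Module.IsTorsion (IwasawaAlgebra p) M)
    (hnf : ∀ N : Submodule (IwasawaAlgebra p) M, Finite N → N = ⊥) {f : IwasawaAlgebra p}
    (hchar : Literature.NumberTheory.EllipticCurves.Module.charIdeal (IwasawaAlgebra p) M = Ideal.span {f}) (h0 : PowerSeries.constantCoeff f ≠ 0) :
    Nat.card (M ⧸ (Ideal.span {(PowerSeries.X : IwasawaAlgebra p)} • ⊤ : Submodule (IwasawaAlgebra p) M)) = p ^ (PowerSeries.constantCoeff f).valuation := by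
  rw [natCard_quotient_X_smul_top_eq_natCard_quotient_span_sup hM hnf hchar (fun h ↦ h0 (PowerSeries.X_dvd_iff.mp h)), natCard_quotient_span_sup_span_X h0]

end NoFinite

/-! ## §2 Any finitely generated torsion `X`: `#(X/TX) = p^{ord_p f(0)} · #(F/TF)`, `p^{μ(X)} ∣ #(X/TX)`, `p^{pⁿ·μ(X)} ∣ #(X/ω_nX)` -/

section General

/-- **`T ∣ f ⟹ X/TX` IS INFINITE** (`Nat.card = 0`) for every f.g. torsion `X` with `char_Λ X = (f)` (gen 55's `natCard_quotient_smul_top_eq_zero_of_dvd` at the distinguished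
polynomial `g = T`, which needs no `g(0) = p`). Equivalently: `X/TX` finite ⟹ `f(0) ≠ 0`. [cite: Washington1997, §13.3] [cite: NeukirchSchmidtWingberg2008, (5.3.1)] -/
theorem natCard_quotient_X_smul_top_eq_zero_of_constantCoeff_eq_zero [Module.Finite (IwasawaAlgebra p) M] (hM : Module.IsTorsion (IwasawaAlgebra p) M)
    {f : IwasawaAlgebra p} (hchar : Literature.NumberTheory.EllipticCurves.Module.charIdeal (IwasawaAlgebra p) M = Ideal.span {f})
    (h0 : PowerSeries.constantCoeff f = 0) :
    Nat.card (M ⧸ (Ideal.span {(PowerSeries.X : IwasawaAlgebra p)} • ⊤ : Submodule (IwasawaAlgebra p) M)) = 0 := by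
  have h := natCard_quotient_smul_top_eq_zero_of_dvd (M := M) (isDistinguishedAt_X p) (by rw [Polynomial.coe_X]; exact PowerSeries.X_prime) hM hchar
    (by rw [Polynomial.coe_X]; exact PowerSeries.X_dvd_iff.mpr h0)
  rwa [Polynomial.coe_X] at h

/-- **`X/TX` finite ⟹ `f(0) ≠ 0`** (contrapositive of the previous statement). [cite: Washington1997, §13.3] -/
theorem constantCoeff_ne_zero_of_natCard_quotient_X_smul_top_ne_zero [Module.Finite (IwasawaAlgebra p) M] (hM : Module.IsTorsion (IwasawaAlgebra p) M)
    {f : IwasawaAlgebra p} (hchar : Literature.NumberTheory.EllipticCurves.Module.charIdeal (IwasawaAlgebra p) M = Ideal.span {f})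
    (hne : Nat.card (M ⧸ (Ideal.span {(PowerSeries.X : IwasawaAlgebra p)} • ⊤ : Submodule (IwasawaAlgebra p) M)) ≠ 0) : PowerSeries.constantCoeff f ≠ 0 :=
  fun h0 ↦ hne (natCard_quotient_X_smul_top_eq_zero_of_constantCoeff_eq_zero hM hchar h0)

/-- ★★★ **THE BASE INDEX OF A GENERAL IWASAWA MODULE.** `X` ANY finitely generated torsion `Λ`-module, `char_Λ X = (f)`, `f(0) ≠ 0`, `F ≤ X` finite with `X/F` free of finite
submodules (the largest finite submodule): **`#(X/TX) = p^{ord_p f(0)} · #(F/TF)`** (`T` is `X/F`-regular since `Λ/(f, T)` is finite; `0 → F/TF → X/TX → (X/F)/T(X/F) → 0`).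
In Iwasawa's notation `e_0 = ord_p f(0) + ord_p #F[T]` (`#(F/TF) = #F[T]` for finite `F`). [cite: Washington1997, §13.3 (Thm. 13.13)] [cite: NeukirchSchmidtWingberg2008, (5.3.17)]
[cite: GreenbergLNM1716, §4 Lemma 4.2 (p. 103)] -/
theorem natCard_quotient_X_smul_top_eq_pow_mul [Module.Finite (IwasawaAlgebra p) M] (hM : Module.IsTorsion (IwasawaAlgebra p) M)
    (F : Submodule (IwasawaAlgebra p) M) [Finite F] (hF : ∀ N : Submodule (IwasawaAlgebra p) (M ⧸ F), Finite N → N = ⊥) {f : IwasawaAlgebra p}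
    (hchar : Literature.NumberTheory.EllipticCurves.Module.charIdeal (IwasawaAlgebra p) M = Ideal.span {f}) (h0 : PowerSeries.constantCoeff f ≠ 0) :
    Nat.card (M ⧸ (Ideal.span {(PowerSeries.X : IwasawaAlgebra p)} • ⊤ : Submodule (IwasawaAlgebra p) M)) =
      p ^ (PowerSeries.constantCoeff f).valuation * Nat.card (F ⧸ (Ideal.span {(PowerSeries.X : IwasawaAlgebra p)} • ⊤ : Submodule (IwasawaAlgebra p) F)) := by
  obtain ⟨hM', hchar'⟩ := isTorsion_and_charIdeal_quotient_eq hM F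
  rw [hchar] at hchar'
  have hkill : ∀ x : M ⧸ F, f • x = 0 := smul_eq_zero_of_charIdeal_eq_span_of_noFiniteSubmodule p (M ⧸ F) hM' hF hchar'
  have hreg : ∀ x : M ⧸ F, (PowerSeries.X : IwasawaAlgebra p) • x = 0 → x = 0 := X_smul_eq_zero_imp hF hkill h0
  rw [natCard_quotient_smul_top_eq_mul_of_quotient_regular F (PowerSeries.X : IwasawaAlgebra p) hreg, natCard_quotient_X_smul_top_eq_pow hM' hF hchar' h0]

/-- ★★ **`p^{ord_p f(0)} ∣ #(X/TX)` and `X/TX` is FINITE** for every f.g. torsion `X` with `char_Λ X = (f)`, `f(0) ≠ 0` (finite submodules allowed).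
[cite: Washington1997, §13.3 (Thm. 13.13)] [cite: GreenbergLNM1716, §4 Lemma 4.2] -/
theorem pow_valuation_dvd_natCard_quotient_X_smul_top [Module.Finite (IwasawaAlgebra p) M] (hM : Module.IsTorsion (IwasawaAlgebra p) M) {f : IwasawaAlgebra p}
    (hchar : Literature.NumberTheory.EllipticCurves.Module.charIdeal (IwasawaAlgebra p) M = Ideal.span {f}) (h0 : PowerSeries.constantCoeff f ≠ 0) :
    p ^ (PowerSeries.constantCoeff f).valuation ∣ Nat.card (M ⧸ (Ideal.span {(PowerSeries.X : IwasawaAlgebra p)} • ⊤ : Submodule (IwasawaAlgebra p) M)) ∧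
    0 < Nat.card (M ⧸ (Ideal.span {(PowerSeries.X : IwasawaAlgebra p)} • ⊤ : Submodule (IwasawaAlgebra p) M)) := by
  haveI : IsNoetherian (IwasawaAlgebra p) M := inferInstance
  obtain ⟨F, hFfin, hFmax⟩ := exists_finite_submodule_forall_finite_le (R := IwasawaAlgebra p) (M := M)
  haveI : Finite F := hFfin
  haveI : Finite (F ⧸ (Ideal.span {(PowerSeries.X : IwasawaAlgebra p)} • ⊤ : Submodule (IwasawaAlgebra p) F)) := Finite.of_surjective _ (Submodule.mkQ_surjective _)
  rw [natCard_quotient_X_smul_top_eq_pow_mul hM F (forall_finite_eq_bot_quotient_of_forall_finite_le F hFmax) hchar h0]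
  exact ⟨Dvd.intro _ rfl, Nat.mul_pos (pow_pos hp.out.pos _) Nat.card_pos⟩

/-- **`X/TX` is finite ⟺ `f(0) ≠ 0`** (`X` f.g. torsion, `char_Λ X = (f)`), in `Nat.card` form: `#(X/TX) ≠ 0 ⟺ f(0) ≠ 0`. [cite: Washington1997, §13.3 (Lemma 13.18)] -/
theorem natCard_quotient_X_smul_top_ne_zero_iff [Module.Finite (IwasawaAlgebra p) M] (hM : Module.IsTorsion (IwasawaAlgebra p) M) {f : IwasawaAlgebra p}
    (hchar : Literature.NumberTheory.EllipticCurves.Module.charIdeal (IwasawaAlgebra p) M = Ideal.span {f}) :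
    Nat.card (M ⧸ (Ideal.span {(PowerSeries.X : IwasawaAlgebra p)} • ⊤ : Submodule (IwasawaAlgebra p) M)) ≠ 0 ↔ PowerSeries.constantCoeff f ≠ 0 :=
  ⟨constantCoeff_ne_zero_of_natCard_quotient_X_smul_top_ne_zero hM hchar, fun h0 ↦ (pow_valuation_dvd_natCard_quotient_X_smul_top hM hchar h0).2.ne'⟩

/-- ★★★ **`p^{μ(f)} ∣ #(X/TX)` UNCONDITIONALLY** — `X` ANY finitely generated torsion `Λ`-module, `char_Λ X = (f)`, ANY prime `p`, finite submodules allowed, no hypothesis on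
`f(0)` (`Nat.card`: if `f(0) = 0` the quotient is infinite and the statement reads `∣ 0`; else `ord_p f(0) = μ(f) + ord_p (pfree f)(0) ≥ μ(f)`). The base case that gens
54–59 carried as an opaque factor. [cite: Washington1997, §13.3 (Thm. 13.13)] [cite: GreenbergLNM1716, Conj. 1.11 and §4 Lemma 4.2] -/
theorem pow_mu_dvd_natCard_quotient_X_smul_top [Module.Finite (IwasawaAlgebra p) M] (hM : Module.IsTorsion (IwasawaAlgebra p) M) {f : IwasawaAlgebra p}
    (hchar : Literature.NumberTheory.EllipticCurves.Module.charIdeal (IwasawaAlgebra p) M = Ideal.span {f}) :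
    p ^ mu f ∣ Nat.card (M ⧸ (Ideal.span {(PowerSeries.X : IwasawaAlgebra p)} • ⊤ : Submodule (IwasawaAlgebra p) M)) := by
  by_cases h0 : PowerSeries.constantCoeff f = 0
  · rw [natCard_quotient_X_smul_top_eq_zero_of_constantCoeff_eq_zero hM hchar h0]; exact dvd_zero _
  · exact (pow_dvd_pow p (valuation_constantCoeff_eq_mu_add_and_le h0).2).trans (pow_valuation_dvd_natCard_quotient_X_smul_top hM hchar h0).1

/-- ★★★ **`p^{μ(X)} ∣ #(X/TX)`** with the `μ`-INVARIANT OF THE MODULE (`μ(X) = μ(f)` for any generator `f` of `char_Λ X`, tree): for EVERY finitely generated torsion `Λ`-module `X`.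
[cite: Washington1997, §13.2–13.3] [cite: GreenbergLNM1716, Conj. 1.11] -/
theorem pow_muInvariant_dvd_natCard_quotient_X_smul_top [Module.Finite (IwasawaAlgebra p) M] (hM : Module.IsTorsion (IwasawaAlgebra p) M) :
    p ^ muInvariant p M ∣ Nat.card (M ⧸ (Ideal.span {(PowerSeries.X : IwasawaAlgebra p)} • ⊤ : Submodule (IwasawaAlgebra p) M)) := by
  obtain ⟨f, hf0, hchar⟩ := exists_charGenerator_ne_zero M hM
  rw [← Summit.BirchSwinnertonDyer.Rank1Residual.X1.MuPart.mu_generator_eq_muInvariant M hM hf0 hchar]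
  exact pow_mu_dvd_natCard_quotient_X_smul_top hM hchar

/-- ★★★ **`p^{pⁿ·μ(X)} ∣ #(X/ω_nX)` for EVERY finitely generated torsion `Λ`-module `X` and EVERY `n`** (`ω_n = (1+T)^{pⁿ} − 1`; `Nat.card`). Gen 56 proved
`p^{(pⁿ−1)·μ(X)} · #(X/TX) ∣ #(X/ω_nX)`; the base factor contributes the missing `p^{μ(X)}`. [cite: Washington1997, §13.3 (Thm. 13.13)] [cite: GreenbergLNM1716, Thm. 1.10, Conj. 1.11] -/
theorem pow_mul_muInvariant_dvd_natCard_quotient_omega [Module.Finite (IwasawaAlgebra p) M] (hM : Module.IsTorsion (IwasawaAlgebra p) M) (n : ℕ) :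
    p ^ (p ^ n * muInvariant p M) ∣
      Nat.card (M ⧸ (Ideal.span {((1 + PowerSeries.X : PowerSeries ℤ_[p]) ^ (p ^ n) - 1 : IwasawaAlgebra p)} • ⊤ : Submodule (IwasawaAlgebra p) M)) := by
  have h1 := pow_mul_natCard_dvd_natCard_quotient_omega hM n
  have h2 := mul_dvd_mul_left (p ^ ((p ^ n - 1) * muInvariant p M)) (pow_muInvariant_dvd_natCard_quotient_X_smul_top hM)
  rw [← pow_add] at h2
  have e : (p ^ n - 1) * muInvariant p M + muInvariant p M = p ^ n * muInvariant p M := by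
    have hpn : 1 ≤ p ^ n := Nat.one_le_pow n p hp.out.pos
    zify [hpn]
    ring
  rw [e] at h2
  exact h2.trans h1

/-- ★★★ **THE `γ`-FREE ONE-LAYER CERTIFICATE: `0 < #(X/ω_nX) < p^{pⁿ}` at ANY ONE `n` ⟹ `μ(X) = 0`** — for EVERY finitely generated torsion `Λ`-module `X` (finite submodules
allowed, any `p`); no growth number, no relative norm, no `λ`. At `n = 0`: `0 < #(X/TX) < p ⟹ μ(X) = 0`. [cite: Washington1997, §13.3 (Thm. 13.13)] [cite: GreenbergLNM1716, Conj. 1.11] -/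
theorem muInvariant_eq_zero_of_natCard_quotient_omega_pos_lt [Module.Finite (IwasawaAlgebra p) M] (hM : Module.IsTorsion (IwasawaAlgebra p) M) {n : ℕ}
    (hpos : 0 < Nat.card (M ⧸ (Ideal.span {((1 + PowerSeries.X : PowerSeries ℤ_[p]) ^ (p ^ n) - 1 : IwasawaAlgebra p)} • ⊤ : Submodule (IwasawaAlgebra p) M)))
    (hlt : Nat.card (M ⧸ (Ideal.span {((1 + PowerSeries.X : PowerSeries ℤ_[p]) ^ (p ^ n) - 1 : IwasawaAlgebra p)} • ⊤ : Submodule (IwasawaAlgebra p) M)) < p ^ (p ^ n)) :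
    muInvariant p M = 0 := by
  have hle := (Nat.le_of_dvd hpos (pow_mul_muInvariant_dvd_natCard_quotient_omega hM n)).trans_lt hlt
  have hexp := (Nat.pow_lt_pow_iff_right hp.out.one_lt).mp hle
  by_contra hμ
  have h1 : 1 ≤ muInvariant p M := Nat.one_le_iff_ne_zero.mpr hμ
  have : p ^ n ≤ p ^ n * muInvariant p M := Nat.le_mul_of_pos_right _ h1
  omega

/-- ★★ **THE `μ`-BOUND AT ONE LAYER: `pⁿ · μ(X) ≤ log_p #(X/ω_nX)`** whenever `X/ω_nX` is finite — every layer climbed divides the bound by `p`. [cite: Washington1997, §13.3 (Thm. 13.13)] -/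
theorem pow_mul_muInvariant_le_log [Module.Finite (IwasawaAlgebra p) M] (hM : Module.IsTorsion (IwasawaAlgebra p) M) {n : ℕ}
    (hpos : 0 < Nat.card (M ⧸ (Ideal.span {((1 + PowerSeries.X : PowerSeries ℤ_[p]) ^ (p ^ n) - 1 : IwasawaAlgebra p)} • ⊤ : Submodule (IwasawaAlgebra p) M))) :
    p ^ n * muInvariant p M ≤ Nat.log p (Nat.card (M ⧸ (Ideal.span {((1 + PowerSeries.X : PowerSeries ℤ_[p]) ^ (p ^ n) - 1 : IwasawaAlgebra p)} • ⊤ :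
      Submodule (IwasawaAlgebra p) M))) :=
  Nat.le_log_of_pow_le hp.out.one_lt (Nat.le_of_dvd hpos (pow_mul_muInvariant_dvd_natCard_quotient_omega hM n))

end General

/-! ## §3 What the base index knows about `λ`: `#(X/TX) = p^{μ}·#(F/TF) ⟺ λ = 0`; `p ∤ #(X/TX) ⟹ μ = λ = 0` -/

section Lambda

/-- ★★ **THE BASE INDEX DETECTS `λ = 0`: `#(X/TX) = p^{μ(f)} · #(F/TF) ⟺ λ(f) = 0`** (`X` f.g. torsion, `char_Λ X = (f)`, `f(0) ≠ 0`, `F` the largest finite submodule):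
the excess of `ord_p f(0)` over `μ(f)` is `ord_p (pfree f)(0)`, positive exactly when the distinguished polynomial of `f` has a root, i.e. `λ(f) ≥ 1`.
[cite: Washington1997, §7.1 (Weierstrass preparation) and §13.3] -/
theorem natCard_quotient_X_smul_top_eq_pow_mu_mul_iff [Module.Finite (IwasawaAlgebra p) M] (hM : Module.IsTorsion (IwasawaAlgebra p) M)
    (F : Submodule (IwasawaAlgebra p) M) [Finite F] (hF : ∀ N : Submodule (IwasawaAlgebra p) (M ⧸ F), Finite N → N = ⊥) {f : IwasawaAlgebra p}
    (hchar : Literature.NumberTheory.EllipticCurves.Module.charIdeal (IwasawaAlgebra p) M = Ideal.span {f}) (h0 : PowerSeries.constantCoeff f ≠ 0) :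
    Nat.card (M ⧸ (Ideal.span {(PowerSeries.X : IwasawaAlgebra p)} • ⊤ : Submodule (IwasawaAlgebra p) M)) =
      p ^ mu f * Nat.card (F ⧸ (Ideal.span {(PowerSeries.X : IwasawaAlgebra p)} • ⊤ : Submodule (IwasawaAlgebra p) F)) ↔ lam f = 0 := by
  haveI : Finite (F ⧸ (Ideal.span {(PowerSeries.X : IwasawaAlgebra p)} • ⊤ : Submodule (IwasawaAlgebra p) F)) := Finite.of_surjective _ (Submodule.mkQ_surjective _)
  rw [natCard_quotient_X_smul_top_eq_pow_mul hM F hF hchar h0, ← natCard_quotient_span_sup_span_X_eq_pow_mu_iff h0, natCard_quotient_span_sup_span_X h0]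
  exact ⟨fun h ↦ Nat.eq_of_mul_eq_mul_right Nat.card_pos h, fun h ↦ by rw [h]⟩

/-- ★★ No finite submodule: **`#(X/TX) = p^{μ(f)} ⟺ λ(f) = 0`** (`char_Λ X = (f)`, `f(0) ≠ 0`). [cite: Washington1997, §7.1 and §13.3] -/
theorem natCard_quotient_X_smul_top_eq_pow_mu_iff [Module.Finite (IwasawaAlgebra p) M] (hM : Module.IsTorsion (IwasawaAlgebra p) M)
    (hnf : ∀ N : Submodule (IwasawaAlgebra p) M, Finite N → N = ⊥) {f : IwasawaAlgebra p}
    (hchar : Literature.NumberTheory.EllipticCurves.Module.charIdeal (IwasawaAlgebra p) M = Ideal.span {f}) (h0 : PowerSeries.constantCoeff f ≠ 0) :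
    Nat.card (M ⧸ (Ideal.span {(PowerSeries.X : IwasawaAlgebra p)} • ⊤ : Submodule (IwasawaAlgebra p) M)) = p ^ mu f ↔ lam f = 0 := by
  rw [natCard_quotient_X_smul_top_eq_pow hM hnf hchar h0, ← natCard_quotient_span_sup_span_X h0]
  exact natCard_quotient_span_sup_span_X_eq_pow_mu_iff h0

/-- ★★ **`λ(f) ≠ 0 ⟹ p^{μ(f)+1} ∣ #(X/TX)`** for every f.g. torsion `X` with `char_Λ X = (f)` (if `f(0) = 0` the right side is `0`). [cite: Washington1997, §7.1 and §13.3] -/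
theorem pow_mu_succ_dvd_natCard_quotient_X_smul_top_of_lam_ne_zero [Module.Finite (IwasawaAlgebra p) M] (hM : Module.IsTorsion (IwasawaAlgebra p) M) {f : IwasawaAlgebra p}
    (hchar : Literature.NumberTheory.EllipticCurves.Module.charIdeal (IwasawaAlgebra p) M = Ideal.span {f}) (hlam : lam f ≠ 0) :
    p ^ (mu f + 1) ∣ Nat.card (M ⧸ (Ideal.span {(PowerSeries.X : IwasawaAlgebra p)} • ⊤ : Submodule (IwasawaAlgebra p) M)) := by
  by_cases h0 : PowerSeries.constantCoeff f = 0
  · rw [natCard_quotient_X_smul_top_eq_zero_of_constantCoeff_eq_zero hM hchar h0]; exact dvd_zero _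
  · refine (pow_dvd_pow p ?_).trans (pow_valuation_dvd_natCard_quotient_X_smul_top hM hchar h0).1
    obtain ⟨heq, hle⟩ := valuation_constantCoeff_eq_mu_add_and_le h0
    -- `ord_p f(0) = μ(f)` would force `λ(f) = 0`
    by_contra hlt
    have hv : (PowerSeries.constantCoeff f).valuation = mu f := by omega
    have hcard : Nat.card (IwasawaAlgebra p ⧸ (Ideal.span {f} ⊔ Ideal.span {(PowerSeries.X : IwasawaAlgebra p)})) = p ^ mu f := by
      rw [natCard_quotient_span_sup_span_X h0, hv]
    exact hlam ((natCard_quotient_span_sup_span_X_eq_pow_mu_iff h0).mp hcard)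

/-- ★★★ **`p ∤ #(X/TX) ⟹ μ(f) = 0 ∧ λ(f) = 0`**, i.e. `char_Λ X = Λ` (`f` is a unit) — the BASE DOOR: a base index prime to `p` (for the `ω`-coinvariants of a torsion Iwasawa
module: `#(X/TX) = 1`, `X = TX`, `X = 0` by Nakayama) kills both invariants. For EVERY f.g. torsion `X` with `char_Λ X = (f)`.
[cite: Washington1997, §7.1, §13.2 (Nakayama, Lemma 13.16) and §13.3] [cite: GreenbergLNM1716, §4 (p. 104: the case `f_E(0) ∈ Λˣ`)] -/
theorem mu_eq_zero_and_lam_eq_zero_of_not_dvd [Module.Finite (IwasawaAlgebra p) M] (hM : Module.IsTorsion (IwasawaAlgebra p) M) {f : IwasawaAlgebra p}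
    (hchar : Literature.NumberTheory.EllipticCurves.Module.charIdeal (IwasawaAlgebra p) M = Ideal.span {f})
    (hnd : ¬ p ∣ Nat.card (M ⧸ (Ideal.span {(PowerSeries.X : IwasawaAlgebra p)} • ⊤ : Submodule (IwasawaAlgebra p) M))) :
    mu f = 0 ∧ lam f = 0 ∧ Literature.NumberTheory.EllipticCurves.Module.charIdeal (IwasawaAlgebra p) M = ⊤ := by
  have hlam : lam f = 0 := by
    by_contra h
    exact hnd ((dvd_pow_self p (Nat.succ_ne_zero _)).trans (pow_mu_succ_dvd_natCard_quotient_X_smul_top_of_lam_ne_zero hM hchar h))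
  have hmu : mu f = 0 := by
    by_contra h
    exact hnd ((dvd_pow_self p h).trans (pow_mu_dvd_natCard_quotient_X_smul_top hM hchar))
  have hf0 : f ≠ 0 := by
    intro hf
    apply hnd
    rw [natCard_quotient_X_smul_top_eq_zero_of_constantCoeff_eq_zero hM hchar (by rw [hf, map_zero])]
    exact dvd_zero _
  have hu : IsUnit f := (isUnit_iff_mu_eq_zero_and_lam_eq_zero f).mpr ⟨hf0, hmu, hlam⟩
  exact ⟨hmu, hlam, by rw [hchar, Ideal.span_singleton_eq_top]; exact hu⟩

end Lambda

end Summit.BirchSwinnertonDyer.BirchSwinnertonDyer.Theorems.AlignedTransportAtTwoHalfDescentBaseIndex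

end
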